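import Summits.Ventures.CertifiedManyBodySolver.Theorems.TcThermcert1FluxBlindnessPencil
import Literature.MathematicalPhysics.QuantumLattice.HubbardNNNHoppingFluxThermal
import HarnessLib

/-!
# Flux-blindness of short walks on the `t–t'` Hubbard torus — part 2: `tr_p H_L(θ)^k = tr_p H_L(0)^k` for `k < L`

For the two-dimensional `t–t'` Hubbard torus threaded by a flux `θ` through a seam (`hubbardTorusTT'Flux L t' U θ`), the first
`L - 1` moments of EVERY coordinate sector block do not depend on the flux (`trace_pow_toBlock_hubbardTorusTT'Flux_eq_zero_flux`,
all `L ≥ 3`, all `t', U, θ`, every predicate `p` on occupation sets), hence the twisted and untwisted sector partition functions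
`β ↦ tr_p e^{−βH_L(θ)}` have the same Taylor jet of order `L - 1` at `β = 0`
(`iteratedDeriv_trace_exp_neg_smul_toBlock_hubbardTorusTT'Flux_eq`). Physically (Byers–Yang): a closed walk of fewer than `L` hops
cannot wind the torus, and only winding walks see the flux. PROOF (gauge + Fourier, no walk combinatorics): in the uniform gauge
(tree `conj_hubbardTorusTT'Flux_eq_uniform`) the Hamiltonian is a trinomial pencil `M₀ + e^{iθ/L} M₊ + e^{−iθ/L} M₋`
(`exists_pencil_uniformTwistTT'`), the gauge transformation is a unit-modulus diagonal (preserving traces of powers of sector blocks,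
`trace_pow_toBlock_uniformTwistTT'_eq`), and the seam form is literally `2π`-periodic in `θ` (`hubbardTorusTT'Flux_add_two_pi`); so the
`k`-th sector moment is a trigonometric polynomial of degree `≤ k` in `ψ = θ/L` with period `2π/L`, constant for `k < L` (part 1).
References: ByersYang1961; Watanabe2019 §2.2.3, §4.1. Provenance: crux workfile
`Cruxes/ThermalStiffnessCeilingU8b10_le_1o8/Lines/zerofree_corridor.lean` §B–§C (tree 6d964f73f6ce), planner `hubbard-floor-idea-rescuer` g6,
line `zerofree_corridor` on K1 = `TcThermcert1.ThermalStiffnessCeilingU8b10_le_1o8` (`--supports stmt-Ventures-26381`).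
HONEST FRAMING: exact lattice combinatorics valid for every `U`; it says nothing by itself about stiffness at `U = 8`;
superconductivity in the Hubbard model is NOT proved (or disproved) by any of this.
-/

noncomputable section

namespace Summit.Ventures.CertifiedManyBodySolver.Theorems.TcThermcert1.FluxBlindness

open Matrix Finset
open Literature.MathematicalPhysics.QuantumLattice
open Literature.MathematicalPhysics.QuantumFieldTheory
open scoped ComplexConjugate

/-! ## (B) The uniformly twisted torus is a pencil in `e^{iθ/L}`; the seam-flux torus is `2π`-periodic and gauge-equivalent -/

section Torus

variable {L : ℕ} [NeZero L]

/-- **The uniformly twisted `t–t'` torus is a trinomial pencil in `e = e^{iθ/L}`**: there are `θ`-independent matrices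
`M₀` (the `e₂`-hops and the repulsion), `M₊` (minus every hop advancing `x₁`: `e₁`-bonds and, with weight `t'`, both diagonal
families), `M₋` (minus every hop retreating `x₁`) with `uniformTwistTT' θ = M₀ + e • M₊ + conj e • M₋` for every `θ`. -/
theorem exists_pencil_uniformTwistTT' (t' U : ℝ) :
    ∃ M₀ Mp Mm : Matrix (Finset (Orb (FermionTorus 2 L))) (Finset (Orb (FermionTorus 2 L))) ℂ, ∀ θ : ℝ,
      uniformTwistTT' L t' U θ =
        M₀ + ((Circle.exp (θ / L) : Circle) : ℂ) • Mp + conj ((Circle.exp (θ / L) : Circle) : ℂ) • Mm := by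
  refine ⟨-(∑ x : Site 2 L, ∑ σ : Fin 2,
      (creation (orb (FermionTorus.ofTorusSite (Site.shift x 1)) σ) * annihilation (orb (FermionTorus.ofTorusSite x) σ) +
        creation (orb (FermionTorus.ofTorusSite x) σ) * annihilation (orb (FermionTorus.ofTorusSite (Site.shift x 1)) σ))) +
      (U : ℂ) • ∑ y : FermionTorus 2 L, numberOp y 0 * numberOp y 1,
    -(∑ x : Site 2 L, ∑ σ : Fin 2,
      creation (orb (FermionTorus.ofTorusSite (Site.shift x 0)) σ) * annihilation (orb (FermionTorus.ofTorusSite x) σ)) +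
      -(t' : ℂ) • ∑ s : Fin 2, ∑ x : Site 2 L, ∑ σ : Fin 2,
        creation (orb (FermionTorus.ofTorusSite (x + torusDiagJump L s)) σ) * annihilation (orb (FermionTorus.ofTorusSite x) σ),
    -(∑ x : Site 2 L, ∑ σ : Fin 2,
      creation (orb (FermionTorus.ofTorusSite x) σ) * annihilation (orb (FermionTorus.ofTorusSite (Site.shift x 0)) σ)) +
      -(t' : ℂ) • ∑ s : Fin 2, ∑ x : Site 2 L, ∑ σ : Fin 2,
        creation (orb (FermionTorus.ofTorusSite x) σ) * annihilation (orb (FermionTorus.ofTorusSite (x + torusDiagJump L s)) σ),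
    fun θ => ?_⟩
  set e : ℂ := ((Circle.exp (θ / L) : Circle) : ℂ) with he
  have h0 : ∀ x : Site 2 L, ((uniformTwistConfig L θ (x, 0) : Circle) : ℂ) = e := fun x => by
    rw [uniformTwistConfig_apply, if_pos rfl]
  have h1 : ∀ x : Site 2 L, ((uniformTwistConfig L θ (x, 1) : Circle) : ℂ) = 1 := fun x => by
    rw [uniformTwistConfig_apply, if_neg (by decide), Circle.coe_one]
  -- the nearest-neighbour hopping in the uniform twist, split by direction and orientation
  have hhop : (∑ x : Site 2 L, ∑ i : Fin 2, ∑ σ : Fin 2,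
      ((((uniformTwistConfig L θ) (x, i) : Circle) : ℂ) •
          (creation (orb (FermionTorus.ofTorusSite (Site.shift x i)) σ) *
            annihilation (orb (FermionTorus.ofTorusSite x) σ)) +
        (starRingEnd ℂ) (((uniformTwistConfig L θ) (x, i) : Circle) : ℂ) •
          (creation (orb (FermionTorus.ofTorusSite x) σ) *
            annihilation (orb (FermionTorus.ofTorusSite (Site.shift x i)) σ)))) =
      e • (∑ x : Site 2 L, ∑ σ : Fin 2,
          creation (orb (FermionTorus.ofTorusSite (Site.shift x 0)) σ) * annihilation (orb (FermionTorus.ofTorusSite x) σ)) +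
      conj e • (∑ x : Site 2 L, ∑ σ : Fin 2,
          creation (orb (FermionTorus.ofTorusSite x) σ) * annihilation (orb (FermionTorus.ofTorusSite (Site.shift x 0)) σ)) +
      ((∑ x : Site 2 L, ∑ σ : Fin 2,
          creation (orb (FermionTorus.ofTorusSite (Site.shift x 1)) σ) * annihilation (orb (FermionTorus.ofTorusSite x) σ)) +
        ∑ x : Site 2 L, ∑ σ : Fin 2,
          creation (orb (FermionTorus.ofTorusSite x) σ) * annihilation (orb (FermionTorus.ofTorusSite (Site.shift x 1)) σ)) := by
    rw [Finset.sum_comm, Fin.sum_univ_two]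
    simp only [h0, h1, map_one, one_smul, Finset.sum_add_distrib, ← Finset.smul_sum]
  -- the diagonal hopping with the constant Peierls amplitude `e`
  have hdiag : diagPeierlsHopping L (fun _ _ => e) =
      e • (∑ s : Fin 2, ∑ x : Site 2 L, ∑ σ : Fin 2,
          creation (orb (FermionTorus.ofTorusSite (x + torusDiagJump L s)) σ) *
            annihilation (orb (FermionTorus.ofTorusSite x) σ)) +
        conj e • (∑ s : Fin 2, ∑ x : Site 2 L, ∑ σ : Fin 2,
          creation (orb (FermionTorus.ofTorusSite x) σ) *
            annihilation (orb (FermionTorus.ofTorusSite (x + torusDiagJump L s)) σ)) := by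
    unfold diagPeierlsHopping
    simp only [Finset.sum_add_distrib, ← Finset.smul_sum]
  unfold uniformTwistTT'
  rw [magneticHubbardTorus_eq, hhop, hdiag]
  simp only [Finset.sum_add_distrib]
  module

/-- `conj e^{iψ} = e^{-iψ}` on the unit circle, in the form used by the pencil lemma. -/
theorem conj_coe_circleExp (ψ : ℝ) :
    conj ((Circle.exp ψ : Circle) : ℂ) = Complex.exp (-((ψ : ℂ) * Complex.I)) := by
  rw [← Circle.coe_inv_eq_conj, ← Circle.exp_neg, Circle.coe_exp]
  push_cast
  ring_nf

/-- The diagonal seam twist is `2π`-periodic in the flux. -/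
theorem diagSeamTwist_add_two_pi (θ : ℝ) : diagSeamTwist L (θ + 2 * Real.pi) = diagSeamTwist L θ := by
  have h : Circle.exp (θ + 2 * Real.pi) = Circle.exp θ := by
    rw [Circle.exp_add, Circle.exp_two_pi, mul_one]
  unfold diagSeamTwist
  rw [h]

/-- **The seam-flux `t–t'` torus is `2π`-periodic in the flux** (only `e^{±iθ}` enters). [cite: ByersYang1961] -/
theorem hubbardTorusTT'Flux_add_two_pi (t' U θ : ℝ) :
    hubbardTorusTT'Flux L t' U (θ + 2 * Real.pi) = hubbardTorusTT'Flux L t' U θ := by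
  rw [hubbardTorusTT'Flux_eq, hubbardTorusTT'Flux_eq, seamTwist_periodic, diagSeamTwist_add_two_pi]

end Torus

/-! ## Gauge invariance of the sector moments -/

section Gauge

variable {L : ℕ} [NeZero L]

/-- **Gauge invariance of the sector moments** (`L ≥ 3`): `tr ((H(θ))|_p)^k = tr ((H_unif(θ))|_p)^k` on every coordinate
sector `p` (the twist `phaseGauge (twistGauge θ)` is diagonal in the occupation basis). [cite: Watanabe2019, §2.2.3 and §4.1] -/
theorem trace_pow_toBlock_uniformTwistTT'_eq (hL : 3 ≤ L) (t' U θ : ℝ)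
    (p : Finset (Orb (FermionTorus 2 L)) → Prop) [Fintype {a // p a}] [DecidableEq {a // p a}] (k : ℕ) :
    (((uniformTwistTT' L t' U θ).toBlock p p) ^ k).trace = (((hubbardTorusTT'Flux L t' U θ).toBlock p p) ^ k).trace := by
  have hunit : ∀ z : Circle, star (z : ℂ) * (z : ℂ) = 1 := fun z => by
    rw [Complex.star_def, ← Complex.normSq_eq_conj_mul_self, Circle.normSq_coe, Complex.ofReal_one]
  rw [uniformTwistTT', ← conj_hubbardTorusTT'Flux_eq_uniform hL t' U θ, phaseGauge_eq, conjTranspose_diagonal_inst]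
  exact trace_pow_toBlock_diagonal_conj _ (fun a => hunit _) _ p k

/-! ## (C) Flux-blindness of the first `L - 1` sector moments -/

/-- **Flux-blindness of short walks** (`L ≥ 3`, every `t', U`, every coordinate sector `p`, every `k < L`):
`tr ((H^{tt'}_L(θ))|_p)^k = tr ((H^{tt'}_L(0))|_p)^k`. In the uniform gauge the `k`-th sector moment is a trigonometric
polynomial of degree `≤ k` in `ψ = θ/L` (§A1); it is `2π`-periodic in `θ`, i.e. `2π/L`-periodic in `ψ` (§B); a trigonometric
polynomial of degree `k < L` with that period is constant (§A2). Physically: a closed walk of fewer than `L` hops cannot wind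
around the torus, so it cannot feel the Aharonov–Bohm flux. [cite: ByersYang1961] -/
theorem trace_pow_toBlock_hubbardTorusTT'Flux_eq_zero_flux (hL : 3 ≤ L) (t' U θ : ℝ)
    (p : Finset (Orb (FermionTorus 2 L)) → Prop) [Fintype {a // p a}] [DecidableEq {a // p a}] {k : ℕ} (hk : k < L) :
    (((hubbardTorusTT'Flux L t' U θ).toBlock p p) ^ k).trace = (((hubbardTorusTT'Flux L t' U 0).toBlock p p) ^ k).trace := by
  have hL0 : (L : ℝ) ≠ 0 := by exact_mod_cast (show L ≠ 0 by omega)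
  -- the moment in the uniform gauge as a function of `ψ = θ/L`
  set f : ℝ → ℂ := fun ψ => (((uniformTwistTT' L t' U (L * ψ)).toBlock p p) ^ k).trace with hf
  -- (A1) structure
  obtain ⟨M₀, Mp, Mm, hpen⟩ := exists_pencil_uniformTwistTT' (L := L) t' U
  obtain ⟨g, hg⟩ := trace_pencil_pow_eq_sum (M₀.toBlock p p) (Mp.toBlock p p) (Mm.toBlock p p) k
  have hstruct : ∀ ψ : ℝ, f ψ = ∑ d ∈ Finset.range (2 * k + 1), g d * Complex.exp ((ψ : ℂ) * Complex.I * ((d : ℂ) - k)) := by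
    intro ψ
    rw [← hg ψ, hf]
    simp only
    rw [hpen, toBlock_pencil, mul_div_cancel_left₀ ψ hL0, conj_coe_circleExp, Circle.coe_exp]
  -- (B) periodicity
  have hper : ∀ ψ : ℝ, f (ψ + 2 * Real.pi / L) = f ψ := by
    intro ψ
    simp only [hf]
    rw [show (L : ℝ) * (ψ + 2 * Real.pi / L) = L * ψ + 2 * Real.pi by field_simp,
      trace_pow_toBlock_uniformTwistTT'_eq hL, trace_pow_toBlock_uniformTwistTT'_eq hL, hubbardTorusTT'Flux_add_two_pi]
  -- (A2) constancy
  have hconst := trigPoly_eq_const_of_periodic hk (by omega) g f hstruct hper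
  have h1 : f (θ / L) = (((hubbardTorusTT'Flux L t' U θ).toBlock p p) ^ k).trace := by
    simp only [hf]
    rw [mul_div_cancel₀ θ hL0, trace_pow_toBlock_uniformTwistTT'_eq hL]
  have h2 : f 0 = (((hubbardTorusTT'Flux L t' U 0).toBlock p p) ^ k).trace := by
    simp only [hf]
    rw [mul_zero, trace_pow_toBlock_uniformTwistTT'_eq hL]
  rw [← h1, ← h2, hconst]

/-- **Flux-blindness is Taylor-flatness at `β = 0`** (every sector, `L ≥ 3`, `k < L`): the sector partition functions
`β ↦ tr_p e^{−β H_L(θ)}` and `β ↦ tr_p e^{−β H_L(0)}` have the same `k`-th derivative at `β = 0`. -/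
theorem iteratedDeriv_trace_exp_neg_smul_toBlock_hubbardTorusTT'Flux_eq (hL : 3 ≤ L) (t' U θ : ℝ)
    (p : Finset (Orb (FermionTorus 2 L)) → Prop) [Fintype {a // p a}] [DecidableEq {a // p a}] {k : ℕ} (hk : k < L) :
    iteratedDeriv k (fun β : ℂ => (NormedSpace.exp (-β • (hubbardTorusTT'Flux L t' U θ).toBlock p p)).trace) 0 =
      iteratedDeriv k (fun β : ℂ => (NormedSpace.exp (-β • (hubbardTorusTT'Flux L t' U 0).toBlock p p)).trace) 0 := by
  rw [iteratedDeriv_trace_exp_neg_smul, iteratedDeriv_trace_exp_neg_smul,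
    trace_pow_toBlock_hubbardTorusTT'Flux_eq_zero_flux hL t' U θ p hk]

end Gauge

end Summit.Ventures.CertifiedManyBodySolver.Theorems.TcThermcert1.FluxBlindness

end
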